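import Literature.MathematicalPhysics.QuantumLattice.HubbardNNNHoppingClusterLowerBound
import HarnessLib

/-!
# The `2 × 3` Anderson-cluster lower bound for the `t–t'–U` Hubbard model in table form

Topic `MathematicalPhysics/QuantumLattice`, family `hubbard`. A thin corollary layer over Part II of
the cluster-embedding machinery (`HubbardNNNHoppingClusterLowerBound.lean`,
`ClusterLowerBound.groundEnergy_hubbardRectTorusTT'_ge_of_openBox_sectors`), in exactly the shape a
certificate of sector floors is consumed:

* `groundEnergy_hubbardOpenBoxTT'_swap` — the open `c × r` cluster Hamiltonian is the coordinate
  transpose of the open `r × c` one, so its sector ground-state energies are the same (site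
  relabelling covariance, Bratteli–Robinson II §5.2.2); hence ONE table of floors serves both
  orientations of Anderson's cover;
* `groundEnergy_hubbardRectTorusTT'_ge_of_boxFloors_2x3` — **table form of the `2 × 3` cluster
  bound** (Anderson 1951 eq. (2); Valentí–Stolze–Hirschfeld 1991 §II for the square-lattice Hubbard
  model): if `σ k ≤ E₀(h_{2×3}(t₁, t₁', U₁), k)` for `k = 0, …, 12` and `m ≤ σ k + μ k` for those `k`,
  then for every `a, b ≥ 3` and `N ≤ 2ab`,
  `2ab · m - 12 μ N ≤ E₀(hubbardRectTorusTT' a b (7 t₁) (4 t₁') (12 U₁), N)`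
  (covering multiplicities `w_nn = 7`, `w_d = 4`, `w_s = 12`, `n_C = 2ab` clusters);
* `energyDensityTT'_ge_of_boxFloors_2x3` — the same table bounds the thermodynamic-limit
  ground-state energy density: `2 m - 12 μ n ≤ e(7 t₁, 4 t₁', 12 U₁; n)` for `0 ≤ n < 2`, `U₁ ≥ 0`
  (finite bound on every `L × L` torus, `L ≥ 3`, divided by `L²`; Ruelle 1969 §3.3 limit via
  `ThermodynamicLimit.energyDensityTT'_ge_of_eventually_ge`).

References: Anderson, Phys. Rev. 83 (1951) 1260, eq. (2) [cite: Anderson1951, eq. (2)];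
Valentí–Stolze–Hirschfeld, Phys. Rev. B 43 (1991) 13743, §II [cite: ValentiStolzeHirschfeld1991, §II];
Bratteli–Robinson II §5.2.2 [cite: BratteliRobinsonII1997, §5.2.2]; Ruelle 1969 §3.3
[cite: Ruelle1969, §3.3]. Everything is proved; no new definitions, no named facts.
-/

noncomputable section

namespace Literature.MathematicalPhysics.QuantumLattice

open Matrix Finset Filter Topology
open scoped ComplexOrder

namespace ClusterLowerBound

/-- **Transposition symmetry of the open cluster.** The open `c × r` box `t–t'–U` Hamiltonian is
carried onto the open `r × c` one by the coordinate swap, so all sector ground-state energies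
agree (covariance of second quantisation under a site bijection). [cite: BratteliRobinsonII1997, §5.2.2] -/
theorem groundEnergy_hubbardOpenBoxTT'_swap (r c : ℕ) (t t' U : ℝ) (N : ℕ) :
    groundEnergy (hubbardOpenBoxTT' c r t t' U) N = groundEnergy (hubbardOpenBoxTT' r c t t' U) N := by
  have hH : ∀ x y, (rectBoxGraph c r).Adj (rectSwap r c x) (rectSwap r c y) ↔
      (rectBoxGraph r c).Adj x y := by
    intro x y
    show ((ofLex x).1 = (ofLex y).1 ∧ lineAdj (ofLex x).2 (ofLex y).2) ∨
        ((ofLex x).2 = (ofLex y).2 ∧ lineAdj (ofLex x).1 (ofLex y).1) ↔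
      ((ofLex x).2 = (ofLex y).2 ∧ lineAdj (ofLex x).1 (ofLex y).1) ∨
        ((ofLex x).1 = (ofLex y).1 ∧ lineAdj (ofLex x).2 (ofLex y).2)
    exact Or.comm
  have hH' : ∀ x y, (rectBoxDiagGraph c r).Adj (rectSwap r c x) (rectSwap r c y) ↔
      (rectBoxDiagGraph r c).Adj x y := by
    intro x y
    show lineAdj (ofLex x).2 (ofLex y).2 ∧ lineAdj (ofLex x).1 (ofLex y).1 ↔
      lineAdj (ofLex x).1 (ofLex y).1 ∧ lineAdj (ofLex x).2 (ofLex y).2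
    exact And.comm
  rw [hubbardOpenBoxTT', hubbardOpenBoxTT',
    ← groundEnergy_relabel (Orb.mapEquiv (rectSwap r c))
      (hamiltonian (rectBoxGraph r c) t U + hamiltonian (rectBoxDiagGraph r c) t' 0) N,
    map_add, relabel_hamiltonian (rectBoxGraph r c) (rectBoxGraph c r) (rectSwap r c) hH t U,
    relabel_hamiltonian (rectBoxDiagGraph r c) (rectBoxDiagGraph c r) (rectSwap r c) hH' t' 0]

/-- **The `2 × 3` Anderson-cluster lower bound, table form.** If `σ k` is a lower bound on the
`k`-particle ground-state energy of the open `2 × 3` cluster Hamiltonian `h_{2×3}(t₁, t₁', U₁)` for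
every `k ≤ 12`, and `m ≤ σ k + μ k` for those `k` (so `m ≤ min_k (σ_k + μ k)`), then on every
`a × b` torus with `a, b ≥ 3` and for every `N ≤ 2ab`:
`2ab · m - 12 μ N ≤ E₀(hubbardRectTorusTT' a b (7t₁) (4t₁') (12U₁), N)` — Anderson's bound for the
cover of the torus by all translates of the `2 × 3` box and of its transpose (`2ab` clusters; every
nearest-neighbour bond covered `7` times, every diagonal bond `4` times, every site `12` times), with
the chemical-potential shift `μ`. [cite: Anderson1951, eq. (2)] [cite: ValentiStolzeHirschfeld1991, §II] -/
theorem groundEnergy_hubbardRectTorusTT'_ge_of_boxFloors_2x3 {σ : ℕ → ℝ} {t₁ t₁' U₁ : ℝ}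
    (hF : ∀ k ≤ 12, σ k ≤ groundEnergy (hubbardOpenBoxTT' 2 3 t₁ t₁' U₁) k)
    {a b : ℕ} (ha : 3 ≤ a) (hb : 3 ≤ b) {t t' U : ℝ} (ht : t = 7 * t₁) (ht' : t' = 4 * t₁')
    (hU : U = 12 * U₁) (μ m : ℝ) (hm : ∀ k ≤ 12, m ≤ σ k + μ * k) {N : ℕ} (hN : N ≤ 2 * (a * b)) :
    2 * ((a : ℝ) * b) * m - 12 * μ * N ≤ groundEnergy (hubbardRectTorusTT' a b t t' U) N := by
  have hr : 2 ≤ a := le_trans (by norm_num) ha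
  have hc : 3 ≤ b := hb
  have hc' : 3 ≤ a := ha
  have hr' : 2 ≤ b := le_trans (by norm_num) hb
  have key := groundEnergy_hubbardRectTorusTT'_ge_of_openBox_sectors (r := 2) (c := 3) ha hb hr hc
    hc' hr' le_rfl (by norm_num) t t' U μ m
  have e1 : t / (((2 - 1) * 3 + (3 - 1) * 2 : ℕ) : ℝ) = t₁ := by rw [ht]; norm_num
  have e2 : t' / ((2 * ((2 - 1) * (3 - 1)) : ℕ) : ℝ) = t₁' := by rw [ht']; norm_num
  have e3 : U / ((2 * (2 * 3) : ℕ) : ℝ) = U₁ := by rw [hU]; norm_num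
  rw [e1, e2, e3] at key
  have hσ : ∀ k ≤ 2 * (2 * 3), m ≤ groundEnergy (hubbardOpenBoxTT' 2 3 t₁ t₁' U₁) k + μ * k :=
    fun k hk => (hm k hk).trans (by linarith [hF k hk])
  have hσ' : ∀ k ≤ 2 * (3 * 2), m ≤ groundEnergy (hubbardOpenBoxTT' 3 2 t₁ t₁' U₁) k + μ * k :=
    fun k hk => by rw [groundEnergy_hubbardOpenBoxTT'_swap]; exact hσ k hk
  have h := key hσ hσ' hN
  push_cast at h
  linarith

open ThermodynamicLimit in
/-- **The `2 × 3` Anderson-cluster lower bound in the thermodynamic limit.** With the same table of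
sector floors and `m ≤ σ k + μ k` (`k ≤ 12`), the grand-canonical ground-state energy density of the
`t–t'–U` model at density `0 ≤ n < 2` (`U₁ ≥ 0`) satisfies `2m - 12 μ n ≤ e(7t₁, 4t₁', 12U₁; n)`: the
finite bound on every `L × L` torus (`L ≥ 3`, `N = N_L(n)`) divided by `L²`, then `L → ∞`
(Ruelle 1969 §3.3). [cite: Anderson1951, eq. (2)] [cite: Ruelle1969, §3.3] -/
theorem energyDensityTT'_ge_of_boxFloors_2x3 {σ : ℕ → ℝ} {t₁ t₁' U₁ : ℝ}
    (hF : ∀ k ≤ 12, σ k ≤ groundEnergy (hubbardOpenBoxTT' 2 3 t₁ t₁' U₁) k)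
    {t t' U : ℝ} (ht : t = 7 * t₁) (ht' : t' = 4 * t₁') (hU : U = 12 * U₁) (hU0 : 0 ≤ U)
    (μ m : ℝ) (hm : ∀ k ≤ 12, m ≤ σ k + μ * k) {n : ℝ} (hn0 : 0 ≤ n) (hn2 : n < 2) :
    2 * m - 12 * μ * n ≤ energyDensityTT' t t' U n := by
  refine energyDensityTT'_ge_of_eventually_ge t t' hU0 hn0 hn2 (c := 2 * m - 12 * μ * n)
    (μ := -(12 * μ)) ?_
  filter_upwards [eventually_ge_atTop 3] with L hL
  have hLpos : (0 : ℝ) < (L : ℝ) ^ 2 := by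
    have : (3 : ℝ) ≤ L := by exact_mod_cast hL
    positivity
  have hN : rectN n L ≤ 2 * (L * L) := rectN_le_two_mul hn0 hn2.le L
  have h := groundEnergy_hubbardRectTorusTT'_ge_of_boxFloors_2x3 hF hL hL ht ht' hU μ m hm hN
  rw [le_div_iff₀ hLpos]
  have e : (2 * m - 12 * μ * n + -(12 * μ) * ((rectN n L : ℝ) / (L : ℝ) ^ 2 - n)) * (L : ℝ) ^ 2 =
      2 * ((L : ℝ) * L) * m - 12 * μ * (rectN n L : ℝ) := by
    field_simp
    ring
  rw [e]
  exact h

end ClusterLowerBound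

end Literature.MathematicalPhysics.QuantumLattice
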